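import Literature.NumberTheory.Automorphic.UnramifiedEigencharactersRankOne
import Literature.NumberTheory.Automorphic.SymplecticRankOneBasicHeckeOperator
import Mathlib.Analysis.Complex.Polynomial.Basic
import HarnessLib

/-!
# Every character of `ℋ(SL₂(K), SL₂(𝒪); k)` is an unramified eigencharacter `λ_χ` (Cartier §IV Cor. 4.2 for `SL₂ = Sp₂`,
# existence half), over any algebraically closed field `k` in which `q` is invertible; over `ℂ` the characters are the
# `λ_{χ_z}`, `z ∈ ℂˣ`, unique up to `z ↦ z⁻¹`, at every finite place of a number field (Macdonald V (3.4); Satake 1963)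

Topic `NumberTheory/Automorphic`; namespace `Literature.NumberTheory.Automorphic.SymplecticCartan` (lane `lit-hodgefound`,
Track 2 foundations; seat `lit-hodgefound-p11`, generation 47, row g47-#9).  THEOREMS ONLY: no definition, no named fact, no
instance, no notation.  Sequel of `SymplecticRankOneBasicHeckeOperator` (g46: `𝒮_q(1_{K₀tK₀}) = q·x + (q-1) + q·x⁻¹`,
`λ_χ(1_{K₀tK₀}) = q(χ(x) + χ(x⁻¹)) + q - 1`, and «an algebra homomorphism out of `ℋ(SL₂(K), SL₂(𝒪); R)` is determined by its
value on the basic Hecke operator») and of `UnramifiedEigencharactersRankOne` (g47-#8: `λ_{χ'} = λ_χ ⟺ χ' ∈ {χ, χ⁻¹}`).  The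
`U(3)`/`U(2)` analogues are g46-#5 (`UnitaryRankOneUnramifiedCharacters`: `exists_heckeEigencharacter_eq_three/two`); this
file supplies the `SL₂` case, which the tree did not have.

## The mathematics

`G = SL₂(K) = Sp₂(K)`, `K₀ = SL₂(𝒪)`, `q = #𝓀`, `T = 1_{K₀tK₀}` the basic Hecke operator (`t = diag(ϖ, ϖ⁻¹)`), `λ_χ = ev_χ ∘ 𝒮_q`
the unramified eigencharacter of a character `χ` of the cocharacter line `Λ = ℤ·x` (`q ∈ kˣ` the residue cardinality).
Given a `k`-algebra character `ψ : ℋ → k`, `k` algebraically closed, put `τ = ψ(T)`; the quadratic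
`q z² + (q - 1 - τ) z + q` has a root `z ∈ k`, necessarily `z ≠ 0`, and then `q(z + z⁻¹) + q - 1 = τ`; for the character
`χ_z : x^m ↦ z^m` one gets `λ_{χ_z}(T) = τ = ψ(T)` (g46), hence **`ψ = λ_{χ_z}`** since `T` generates `ℋ` (g46).  This is
the existence half of Cartier's Corollary 4.2 («the homomorphisms `ℋ(G, K) → ℂ` are the `ω_χ`»); with g47-#8 (`λ_{χ_z} = λ_{χ_{z'}}
⟺ z' ∈ {z, z⁻¹}`): **`Hom_{ℂ-alg}(ℋ(SL₂(K), SL₂(𝒪); ℂ), ℂ) = {λ_{χ_z}} ≅ ℂˣ/(z ∼ z⁻¹)`**, and the same at every finite place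
`v` of a number field `F` for `ℋ(SL₂(F_v), SL₂(𝒪_v); ℂ)`.

## What is formalised (theorems only)

* §1 (`k` an algebraically closed field, `q ∈ kˣ` the residue cardinality) `exists_root_quadratic_symm`
  (`∃ z ≠ 0, q z² + b z + q = 0`), **`exists_eq_symplecticHeckeEigencharacter_rank_one`** (every `k`-algebra character of
  `ℋ(SL₂(K), SL₂(𝒪); k)` is a `λ_χ`).
* §2 (`k = ℂ`) `laurentMonomialHom_const_ofAdd_rank_one` (`χ_z(x^m) = z^m`),
  **`exists_eq_symplecticHeckeEigencharacter_laurent_rank_one`** (`ψ = λ_{χ_z}`, `z ∈ ℂˣ`),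
  **`symplecticHeckeEigencharacter_laurent_eq_iff_rank_one`** (`λ_{χ_{z'}} = λ_{χ_z} ⟺ z' = z ∨ z' = z⁻¹`),
  `exists_eq_symplecticHeckeEigencharacterAdic_rank_one`, `symplecticHeckeEigencharacterAdic_laurent_eq_iff_rank_one`
  (every finite place of a number field).

## References
* [CartierCorvallis1979] P. Cartier, *Representations of 𝔭-adic groups: a survey*, PSPM 33.1 (1979), §IV (4.2), Thm. 4.1, Cor. 4.2.
* [Macdonald1995] I. G. Macdonald, *Symmetric Functions and Hall Polynomials*, 2nd ed. (1995), Ch. V (2.6), (3.4).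
* [Satake1963] I. Satake, Publ. Math. IHÉS 18 (1963), §§6–7.
-/

noncomputable section

open scoped Valued WithZero Matrix MatrixGroups
open Matrix MonoidAlgebra Representation NumberField IsDedekindDomain Polynomial

namespace Literature.NumberTheory.Automorphic.SymplecticCartan

open Literature.NumberTheory.Automorphic.CartanUnique Literature.NumberTheory.Automorphic

/-! ## §1 Every `k`-character of `ℋ(SL₂(K), SL₂(𝒪); k)` is a `λ_χ` (`k` algebraically closed) -/

/-- **A root of the symmetric quadratic `q z² + b z + q`** (`q ≠ 0`) in an algebraically closed field; it is non-zero.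
[cite: CartierCorvallis1979, §IV Cor. 4.2] -/
theorem exists_root_quadratic_symm {k : Type*} [Field k] [IsAlgClosed k] {q : k} (hq : q ≠ 0) (b : k) :
    ∃ z : k, z ≠ 0 ∧ q * z ^ 2 + b * z + q = 0 := by
  obtain ⟨z, hz⟩ := IsAlgClosed.exists_root (C q * X ^ 2 + C b * X + C q) (by
    rw [Polynomial.degree_quadratic hq]; decide)
  simp only [IsRoot.def, eval_add, eval_mul, eval_C, eval_pow, eval_X] at hz
  refine ⟨z, fun h => hq ?_, hz⟩
  rw [h, zero_pow two_ne_zero, mul_zero, mul_zero, zero_add, zero_add] at hz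
  exact hz

section AlgClosed

variable {K : Type*} [Field K] [Valued K ℤᵐ⁰] {ϖ : K} {k : Type*} [Field k] [IsAlgClosed k]
  (hϖ : Valued.v ϖ = WithZero.exp (-1 : ℤ)) [Finite 𝓀[K]]
  [IsHeckeTriple (⊤ : Submonoid (symplecticGroup (Fin 1) K)) (symplecticInt (Fin 1) K) (symplecticInt (Fin 1) K)]
include hϖ

/-- **EVERY `k`-ALGEBRA CHARACTER OF `ℋ(SL₂(K), SL₂(𝒪); k)` IS AN UNRAMIFIED EIGENCHARACTER `λ_χ`** (`k` algebraically closed,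
`q ∈ kˣ` the residue cardinality — e.g. `k = ℂ`, or `k = 𝔽̄_ℓ`, `ℓ ∤ q`): with `τ = ψ(1_{K₀tK₀})` and `z ≠ 0` a root of
`q z² + (q - 1 - τ) z + q`, the character `χ_z : x^m ↦ z^m` has `λ_{χ_z}(1_{K₀tK₀}) = q(z + z⁻¹) + q - 1 = τ`, so `ψ = λ_{χ_z}`
because the basic Hecke operator generates `ℋ` (Cartier Cor. 4.2, existence half). [cite: CartierCorvallis1979, §IV Thm. 4.1, Cor. 4.2]
[cite: Macdonald1995, Ch. V (3.4)] [cite: Satake1963, §§6–7] -/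
theorem exists_eq_symplecticHeckeEigencharacter_rank_one (q : kˣ) (hq : (q : k) = Nat.card 𝓀[K])
    (ψ : heckeAlgebra k (symplecticGroup (Fin 1) K) (symplecticInt (Fin 1) K) →ₐ[k] k) :
    ∃ χ : Multiplicative (Fin 1 → ℤ) →* k, ψ = symplecticHeckeEigencharacter hϖ q χ := by
  set t := ψ (heckeAlgebra.doubleCosetOperator (symplecticInt (Fin 1) K)
      (⟨Matrix.diagonal (Sum.elim (fun _ : Fin 1 => ϖ ^ (1 : ℕ)) (fun _ : Fin 1 => (ϖ ^ (1 : ℕ))⁻¹)),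
        diagonal_pow_mem_symplecticGroup (uniformizer_ne_zero hϖ) (fun _ : Fin 1 => 1)⟩ : symplecticGroup (Fin 1) K)) with ht
  obtain ⟨z, hz0, hz⟩ := exists_root_quadratic_symm (Units.ne_zero q) ((q : k) - 1 - t)
  obtain ⟨χ, hχ⟩ := exists_monoidHom_apply_ofAdd_eq_units_zpow (Λ := Fin 1 → ℤ) (Units.mk0 z hz0)
    (Pi.evalAddMonoidHom (fun _ : Fin 1 => ℤ) 0)
  refine ⟨χ, algHom_ext_doubleCosetOperator_basic_symplectic hϖ q hq ?_⟩
  rw [symplecticHeckeEigencharacter_doubleCosetOperator_basic hϖ q hq, hχ, hχ, Pi.evalAddMonoidHom_apply,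
    Pi.evalAddMonoidHom_apply, zpow_one, _root_.zpow_neg, zpow_one, Units.val_inv_eq_inv_val, Units.val_mk0, ← ht]
  field_simp
  linear_combination -hz

end AlgClosed

/-! ## §2 Over `ℂ`: `Hom(ℋ(SL₂(K), SL₂(𝒪); ℂ), ℂ) = {λ_{χ_z}} = ℂˣ/(z ∼ z⁻¹)`, locally and at every finite place -/

/-- The character `χ_z : x^m ↦ z^m` of the cocharacter line (`laurentMonomialHom` of the constant parameter `z`).
[cite: CartierCorvallis1979, §IV (4.2)] -/
theorem laurentMonomialHom_const_ofAdd_rank_one (z : ℂˣ) (μ : Fin 1 → ℤ) :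
    laurentMonomialHom (fun _ : Fin 1 => z) (Multiplicative.ofAdd μ) = ((z ^ μ 0 : ℂˣ) : ℂ) := by
  change (((∏ i : Fin 1, (fun _ : Fin 1 => z) i ^ (Multiplicative.toAdd (Multiplicative.ofAdd μ) i)) : ℂˣ) : ℂ) = _
  rw [toAdd_ofAdd, Fin.prod_univ_one]

section Complex

variable {K : Type*} [Field K] [Valued K ℤᵐ⁰] {ϖ : K} (hϖ : Valued.v ϖ = WithZero.exp (-1 : ℤ)) [Finite 𝓀[K]]
  [IsHeckeTriple (⊤ : Submonoid (symplecticGroup (Fin 1) K)) (symplecticInt (Fin 1) K) (symplecticInt (Fin 1) K)]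
include hϖ

/-- **Every `ℂ`-character of `ℋ(SL₂(K), SL₂(𝒪); ℂ)` is `λ_{χ_z}` for some `z ∈ ℂˣ`.** [cite: CartierCorvallis1979, §IV Cor. 4.2]
[cite: Macdonald1995, Ch. V (3.4)] -/
theorem exists_eq_symplecticHeckeEigencharacter_laurent_rank_one (q : ℂˣ) (hq : (q : ℂ) = Nat.card 𝓀[K])
    (ψ : heckeAlgebra ℂ (symplecticGroup (Fin 1) K) (symplecticInt (Fin 1) K) →ₐ[ℂ] ℂ) :
    ∃ z : ℂˣ, ψ = symplecticHeckeEigencharacter hϖ q (laurentMonomialHom fun _ : Fin 1 => z) := by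
  set t := ψ (heckeAlgebra.doubleCosetOperator (symplecticInt (Fin 1) K)
      (⟨Matrix.diagonal (Sum.elim (fun _ : Fin 1 => ϖ ^ (1 : ℕ)) (fun _ : Fin 1 => (ϖ ^ (1 : ℕ))⁻¹)),
        diagonal_pow_mem_symplecticGroup (uniformizer_ne_zero hϖ) (fun _ : Fin 1 => 1)⟩ : symplecticGroup (Fin 1) K)) with ht
  obtain ⟨z, hz0, hz⟩ := exists_root_quadratic_symm (Units.ne_zero q) ((q : ℂ) - 1 - t)
  refine ⟨Units.mk0 z hz0, algHom_ext_doubleCosetOperator_basic_symplectic hϖ q hq ?_⟩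
  rw [symplecticHeckeEigencharacter_doubleCosetOperator_basic hϖ q hq, laurentMonomialHom_const_ofAdd_rank_one,
    laurentMonomialHom_const_ofAdd_rank_one, zpow_one, _root_.zpow_neg, zpow_one, Units.val_inv_eq_inv_val, Units.val_mk0, ← ht]
  field_simp
  linear_combination -hz

/-- **`λ_{χ_{z'}} = λ_{χ_z} ⟺ z' = z ∨ z' = z⁻¹`** (`z, z' ∈ ℂˣ`; g47-#8 read on the parameters).
[cite: CartierCorvallis1979, §IV Cor. 4.2] [cite: Macdonald1995, Ch. V (3.4)] -/
theorem symplecticHeckeEigencharacter_laurent_eq_iff_rank_one (q : ℂˣ) (hq : (q : ℂ) = Nat.card 𝓀[K]) (z z' : ℂˣ) :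
    symplecticHeckeEigencharacter hϖ q (laurentMonomialHom fun _ : Fin 1 => z') =
        symplecticHeckeEigencharacter hϖ q (laurentMonomialHom fun _ : Fin 1 => z) ↔ (z' = z ∨ z' = z⁻¹) := by
  rw [symplecticHeckeEigencharacter_eq_iff_rank_one hϖ q hq]
  have hval : ∀ w : ℂˣ, laurentMonomialHom (fun _ : Fin 1 => w) (Multiplicative.ofAdd fun _ : Fin 1 => (1 : ℤ)) = (w : ℂ) :=
    fun w => by rw [laurentMonomialHom_const_ofAdd_rank_one, zpow_one]
  constructor
  · rintro (h | h)
    · left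
      have h1 := DFunLike.congr_fun h (Multiplicative.ofAdd fun _ : Fin 1 => (1 : ℤ))
      rw [hval, hval] at h1
      exact Units.val_injective h1
    · right
      have h1 := DFunLike.congr_fun h (Multiplicative.ofAdd fun _ : Fin 1 => (1 : ℤ))
      rw [hval, MonoidHom.comp_apply, invMonoidHom_apply, ← ofAdd_neg, laurentMonomialHom_const_ofAdd_rank_one,
        Pi.neg_apply, _root_.zpow_neg, zpow_one] at h1
      exact Units.val_injective h1
  · rintro (rfl | rfl)
    · exact Or.inl rfl
    · right
      rw [← laurentMonomialHom_inv]
      rfl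

/-- **CARTIER'S COROLLARY 4.2 FOR `SL₂(K)` OVER `ℂ`**: the `ℂ`-characters of `ℋ(SL₂(K), SL₂(𝒪); ℂ)` are exactly the `λ_{χ_z}`,
`z ∈ ℂˣ`, and `λ_{χ_z}` determines `z` up to `z ↦ z⁻¹` — `Hom(ℋ, ℂ) ≅ ℂˣ/(z ∼ z⁻¹)`. [cite: CartierCorvallis1979, §IV Thm. 4.1, Cor. 4.2]
[cite: Macdonald1995, Ch. V (3.4)] [cite: Satake1963, §§6–7] -/
theorem symplecticHeckeEigencharacter_laurent_surjective_and_eq_iff_rank_one (q : ℂˣ) (hq : (q : ℂ) = Nat.card 𝓀[K]) :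
    (∀ ψ : heckeAlgebra ℂ (symplecticGroup (Fin 1) K) (symplecticInt (Fin 1) K) →ₐ[ℂ] ℂ,
        ∃ z : ℂˣ, ψ = symplecticHeckeEigencharacter hϖ q (laurentMonomialHom fun _ : Fin 1 => z)) ∧
      ∀ z z' : ℂˣ, symplecticHeckeEigencharacter hϖ q (laurentMonomialHom fun _ : Fin 1 => z') =
          symplecticHeckeEigencharacter hϖ q (laurentMonomialHom fun _ : Fin 1 => z) ↔ (z' = z ∨ z' = z⁻¹) :=
  ⟨exists_eq_symplecticHeckeEigencharacter_laurent_rank_one hϖ q hq,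
    symplecticHeckeEigencharacter_laurent_eq_iff_rank_one hϖ q hq⟩

end Complex

section NumberField

variable (F : Type*) [Field F] [NumberField F] (v : HeightOneSpectrum (𝓞 F))

/-- **Every `ℂ`-character of `ℋ(SL₂(F_v), SL₂(𝒪_v); ℂ)` is `λ_{χ_z}` for some `z ∈ ℂˣ`**, at every finite place `v`.
[cite: CartierCorvallis1979, §IV Cor. 4.2] [cite: Macdonald1995, Ch. V (3.4)] -/
theorem exists_eq_symplecticHeckeEigencharacterAdic_rank_one
    (ψ : heckeAlgebra ℂ (symplecticGroup (Fin 1) (v.adicCompletion F)) (symplecticInt (Fin 1) (v.adicCompletion F)) →ₐ[ℂ] ℂ) :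
    ∃ z : ℂˣ, ψ = symplecticHeckeEigencharacterAdic F v (laurentMonomialHom fun _ : Fin 1 => z) := by
  haveI := finite_residueField_adicCompletion F v
  haveI := isHeckeTriple_symplecticInt_adicCompletion F v (l := Fin 1)
  exact exists_eq_symplecticHeckeEigencharacter_laurent_rank_one (v_adicUniformizer F v) (residueNormUnit F v)
    (coe_residueNormUnit_eq_natCard F v) ψ

/-- **`λ_{χ_{z'}} = λ_{χ_z} ⟺ z' ∈ {z, z⁻¹}` for `ℋ(SL₂(F_v), SL₂(𝒪_v); ℂ)`** at every finite place `v`.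
[cite: CartierCorvallis1979, §IV Cor. 4.2] -/
theorem symplecticHeckeEigencharacterAdic_laurent_eq_iff_rank_one (z z' : ℂˣ) :
    symplecticHeckeEigencharacterAdic F v (laurentMonomialHom fun _ : Fin 1 => z') =
        symplecticHeckeEigencharacterAdic F v (laurentMonomialHom fun _ : Fin 1 => z) ↔ (z' = z ∨ z' = z⁻¹) := by
  haveI := finite_residueField_adicCompletion F v
  haveI := isHeckeTriple_symplecticInt_adicCompletion F v (l := Fin 1)
  exact symplecticHeckeEigencharacter_laurent_eq_iff_rank_one (v_adicUniformizer F v) (residueNormUnit F v)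
    (coe_residueNormUnit_eq_natCard F v) z z'

end NumberField

end Literature.NumberTheory.Automorphic.SymplecticCartan
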